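import Literature.NumberTheory.Rogawski1990.LocalNormFibreBlockDichotomyDock      -- ★ p841689 F0P3a-p08: the dock frame, `twistGram_dockFrame_eq_finSum` (+ the B3-alg chain, `twistGram`, `finSum`)
import HarnessLib

/-!
# The BAD FRAME exists: from the dock frame of `ε` a frame `P′` of the OTHER rank-2 determinant class (Rogawski 1990, §3.8 Prop. 3.8.1 (d): the two classes of the
# stable class of `a·1₂ ⊕ u` at a non-split place) — the caller's data `hP′`, `hnn` of ★ `side_of_dock` ∕ `disj_of_dock`

Topic `NumberTheory/Rogawski1990`; namespace `Literature.NumberTheory.Rogawski1990`.  THEOREMS ONLY (no definition, no instance, no notation, no named fact,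
no `sorry`).  Cell `pub/hodgecm-mathlib` (D-0151), crux H413 = stmt-HodgeConjecture-24833, floor-2 line «N6nsGerm», stub `stub_N6nsS1`; brick **(b2) «THE BAD FRAME
EXISTS»** = the caller's data of the (R-inv) junction ★ p841647 ∕ the dock adapter ★ p841689; seat F0P3a-p08 (g13).  HONEST LABEL: HC_CM is proved only modulo the printed
citations until rung 0 closes; unconditional local linear algebra.

THE MATHEMATICS.  Let `G₁ ⊕ᶠ (g)` be a block-diagonal hermitian Gram matrix over a commutative ring with involution `σ` (at CM: the Gram matrix of the dock frame `y·W`, ★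
`twistGram_dockFrame_eq_finSum`).  For a vector `x` of the plane with `q := h_{G₁}(x, x)` put `ℓ := ᵗ(σx)·G₁` and `x⊥ := (ℓ₁, −ℓ₀)` (so `h_{G₁}(x, x⊥) = 0`); the matrix
`P₀ := (x⊥ | e₃ | x)` (columns) has `det P₀ = −q` and block-diagonalises the form AGAIN: `ᵗ(σP₀)(G₁ ⊕ᶠ g)P₀ = diag(q⊥, g) ⊕ᶠ (q)` with `q⊥ = h_{G₁}(x⊥, x⊥) = q·det G₁` (§1, any
ring).  Over `E_v` at a NON-SPLIT place a non-degenerate hermitian plane represents every `σ`-fixed unit (★ `exists_hermForm_self_eq_one`), so we may take `q = g·n₀` with `n₀` a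
NON-NORM (★ `exists_conjLocal_eq_not_exists_norm`): then `P₀` is invertible and the new rank-2 block has determinant `q⊥·g = det G₁ · n₀ · N(g)`, NOT in the class of `det G₁`
(§2 `exists_badFrame_of_finSum`); composing with any frame `P` of `H` with Gram `G₁ ⊕ᶠ (g)` gives the frame `P·P₀` of `H` in the other class (`exists_badFrame`).  §3 reads this at
the CM carriers on the dock frame (`exists_badFrame_dock`) — exactly the binders `hP′`, `hnn` of ★ `side_of_dock` ∕ `disj_of_dock`.

## References
* [Rogawski1990] J. D. Rogawski, *Automorphic Representations of Unitary Groups in Three Variables*, Ann. of Math. Stud. 123 (1990): §3.8 Prop. 3.8.1 (d) p. 30 (`𝓡(G′_{γ′}∕F_v)`,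
  `F_v^*∕NE_v^*` has order two: both classes occur).
* [Jacobowitz1962] R. Jacobowitz, *Hermitian forms over local fields*, Amer. J. Math. 84 (1962), §3 Thm. 3.1.
-/

set_option autoImplicit false

noncomputable section

open NumberField IsDedekindDomain Matrix Polynomial
open scoped MatrixGroups

namespace Literature.NumberTheory.Rogawski1990

open Literature.NumberTheory.Automorphic Literature.NumberTheory.Automorphic.UnitaryGroup
open Literature.AlgebraicGeometry.ShimuraVarieties (unitaryGroup)

/-! ## §1 Ring-generic: re-framing a block-diagonal Gram matrix through an anisotropic vector of the plane -/

section Generic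

variable {S : Type*} [CommRing S] (σ : S →+* S)

/-- The `2 × 2` ⊕ `1 × 1` block matrix in coordinates. [folklore] -/
private theorem finSum_two_one_eq₃ (B : Matrix (Fin 2) (Fin 2) S) (C : Matrix (Fin 1) (Fin 1) S) :
    finSum 2 1 B C = !![B 0 0, B 0 1, 0; B 1 0, B 1 1, 0; 0, 0, C 0 0] := by
  ext i j
  fin_cases i <;> fin_cases j <;> simp [finSum, Matrix.fromBlocks, finSumFinEquiv, Fin.addCases]

/-- **RE-FRAMING THROUGH A VECTOR OF THE PLANE.**  `G₁` `σ`-hermitian (`σ` an involution), `x : Fin 2 → S`, `ℓ = ᵗ(σx)G₁`, `x⊥ = (ℓ₁, −ℓ₀)`, `q = h(x,x)`, `q⊥ = h(x⊥, x⊥)`,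
`P₀ = (x⊥ | e₃ | x)`: `ᵗ(σP₀)·(G₁ ⊕ᶠ g)·P₀ = diag(q⊥, g) ⊕ᶠ (q)`. [cite: Rogawski1990, §3.8 Prop. 3.8.1 (d) p. 30] -/
theorem twistGram_finSum_reframe (hσ : ∀ s, σ (σ s) = s) {G₁ : Matrix (Fin 2) (Fin 2) S} (hG₁ : (G₁.map σ)ᵀ = G₁) (g : S) (x : Fin 2 → S) :
    twistGram σ (finSum 2 1 G₁ !![g])
        !![σ (x 0) * G₁ 0 1 + σ (x 1) * G₁ 1 1, 0, x 0; -(σ (x 0) * G₁ 0 0 + σ (x 1) * G₁ 1 0), 0, x 1; 0, 1, 0] =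
      finSum 2 1 !![hermForm σ G₁ ![σ (x 0) * G₁ 0 1 + σ (x 1) * G₁ 1 1, -(σ (x 0) * G₁ 0 0 + σ (x 1) * G₁ 1 0)]
          ![σ (x 0) * G₁ 0 1 + σ (x 1) * G₁ 1 1, -(σ (x 0) * G₁ 0 0 + σ (x 1) * G₁ 1 0)], 0; 0, g] !![hermForm σ G₁ x x] := by
  -- hermitian entries: `G₁ 1 0 = σ (G₁ 0 1)`, `σ (G₁ 0 0) = G₁ 0 0`, `σ (G₁ 1 1) = G₁ 1 1`
  have h00 : σ (G₁ 0 0) = G₁ 0 0 := by have h := congrFun (congrFun hG₁ 0) 0; rwa [Matrix.transpose_apply, Matrix.map_apply] at h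
  have h11 : σ (G₁ 1 1) = G₁ 1 1 := by have h := congrFun (congrFun hG₁ 1) 1; rwa [Matrix.transpose_apply, Matrix.map_apply] at h
  have h10 : σ (G₁ 0 1) = G₁ 1 0 := by have h := congrFun (congrFun hG₁ 1) 0; rwa [Matrix.transpose_apply, Matrix.map_apply] at h
  have h01 : σ (G₁ 1 0) = G₁ 0 1 := by have h := congrFun (congrFun hG₁ 0) 1; rwa [Matrix.transpose_apply, Matrix.map_apply] at h
  have hx0 : σ (σ (x 0)) = x 0 := hσ _
  have hx1 : σ (σ (x 1)) = x 1 := hσ _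
  rw [finSum_two_one_eq₃, finSum_two_one_eq₃, twistGram_def]
  ext i j
  fin_cases i <;> fin_cases j <;>
    simp [Matrix.mul_apply, Fin.sum_univ_three, Matrix.transpose_apply, Matrix.map_apply, hermForm_apply, dotProduct, Matrix.mulVec,
      Fin.sum_univ_two, map_add, map_mul, map_neg, h00, h11, h10, h01, hx0, hx1] <;> ring

/-- `det (x⊥ | e₃ | x) = −h(x, x)`. [cite: Rogawski1990, §3.8 Prop. 3.8.1 (d) p. 30] -/
theorem det_reframe (G₁ : Matrix (Fin 2) (Fin 2) S) (x : Fin 2 → S) :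
    (!![σ (x 0) * G₁ 0 1 + σ (x 1) * G₁ 1 1, 0, x 0; -(σ (x 0) * G₁ 0 0 + σ (x 1) * G₁ 1 0), 0, x 1; 0, 1, 0] : Matrix (Fin 3) (Fin 3) S).det =
      -hermForm σ G₁ x x := by
  rw [Matrix.det_fin_three]
  simp [hermForm_apply, dotProduct, Matrix.mulVec, Fin.sum_univ_two]
  ring

end Generic

/-! ## §2 Over `E_v` at a non-split place: the bad frame -/

section Local

variable {F : Type} (E : Type) [Field F] [NumberField F] [Field E] [NumberField E] [Algebra F E]
  [Algebra.IsQuadraticExtension F E] (v : HeightOneSpectrum (𝓞 F)) (c : E ≃ₐ[F] E) {δ : E} (hcδ : c δ = -δ) (hδ : δ ≠ 0)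

/-- `h_{a • G}(x, y) = a · h_G(x, y)`. [folklore] -/
private theorem hermForm_matrix_smul₂ {S : Type*} [CommRing S] (σ : S →+* S) (a : S) (G : Matrix (Fin 2) (Fin 2) S) (x y : Fin 2 → S) :
    UnitaryGroup.hermForm σ (a • G) x y = a * UnitaryGroup.hermForm σ G x y := by
  simp only [hermForm_apply, dotProduct, Matrix.mulVec, Fin.sum_univ_two, Matrix.smul_apply, smul_eq_mul]
  ring

include hcδ hδ in
/-- **THE BAD FRAME, block form.**  Over `E_v`, `v` non-split: `G₁` hermitian with unit determinant, `g` a `σ`-fixed unit.  There are an invertible `P₀` and blocks `G₁′`, `(g′)` with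
`ᵗ(σP₀)·(G₁ ⊕ᶠ g)·P₀ = G₁′ ⊕ᶠ (g′)` and `det G₁′ ∉ det G₁ · N(E_vˣ)` — a vector `x` of the plane with `h(x,x) = g·n₀`, `n₀` a non-norm, re-framed as in §1.
[cite: Rogawski1990, §3.8 Prop. 3.8.1 (d) p. 30] [cite: Jacobowitz1962, §3 Thm. 3.1] -/
theorem exists_badFrame_of_finSum (w : PlacesOver E v) (hw : c • w.1 = w.1) {G₁ : Matrix (Fin 2) (Fin 2) (LocalRing E v)}
    (hG₁ : (G₁.map (conjLocal E c v))ᵀ = G₁) (hG₁d : IsUnit G₁.det) {g : LocalRing E v} (hgσ : conjLocal E c v g = g) (hg : IsUnit g) :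
    ∃ (P₀ : GL (Fin (2 + 1)) (LocalRing E v)) (G₁' : Matrix (Fin 2) (Fin 2) (LocalRing E v)) (G₂' : Matrix (Fin 1) (Fin 1) (LocalRing E v)),
      twistGram (conjLocal E c v) (finSum 2 1 G₁ !![g]) P₀.val = finSum 2 1 G₁' G₂' ∧
        ¬ ∃ z : LocalRing E v, IsUnit z ∧ G₁'.det = G₁.det * (conjLocal E c v z * z) := by
  have hσ : ∀ s, conjLocal E c v (conjLocal E c v s) = s := Liu2021.LemD1OfPlace.conjLocal_conjLocal_apply E v c hcδ hδ
  -- a non-norm `n₀` and a vector of the plane with `h(x, x) = g n₀`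
  obtain ⟨n₀, hn₀σ, hn₀u, hn₀⟩ := exists_conjLocal_eq_not_exists_norm E v c hcδ hδ w hw
  obtain ⟨qu, hqu⟩ := hg.mul hn₀u
  have hqσ : conjLocal E c v (g * n₀) = g * n₀ := by rw [map_mul, hgσ, hn₀σ]
  have hqiσ : conjLocal E c v ((qu⁻¹ : (LocalRing E v)ˣ) : LocalRing E v) = ((qu⁻¹ : (LocalRing E v)ˣ) : LocalRing E v) := by
    have h1 : conjLocal E c v (qu : LocalRing E v) * conjLocal E c v ((qu⁻¹ : (LocalRing E v)ˣ) : LocalRing E v) = 1 := by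
      rw [← map_mul, Units.mul_inv, map_one]
    rw [hqu, hqσ, ← hqu] at h1
    calc conjLocal E c v ((qu⁻¹ : (LocalRing E v)ˣ) : LocalRing E v)
        = ((qu⁻¹ : (LocalRing E v)ˣ) : LocalRing E v) * ((qu : LocalRing E v) * conjLocal E c v ((qu⁻¹ : (LocalRing E v)ˣ) : LocalRing E v)) := by
          rw [← mul_assoc, Units.inv_mul, one_mul]
      _ = _ := by rw [h1, mul_one]
  have hG' : ((((qu⁻¹ : (LocalRing E v)ˣ) : LocalRing E v) • G₁).map (conjLocal E c v))ᵀ = ((qu⁻¹ : (LocalRing E v)ˣ) : LocalRing E v) • G₁ := by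
    rw [Matrix.map_smul' _ _ _ (map_mul _), Matrix.transpose_smul, hqiσ, hG₁]
  have hG'd : IsUnit (((qu⁻¹ : (LocalRing E v)ˣ) : LocalRing E v) • G₁).det := by
    rw [Matrix.det_smul, Fintype.card_fin]
    exact ((qu⁻¹).isUnit.pow 2).mul hG₁d
  obtain ⟨x, hx⟩ := exists_hermForm_self_eq_one E v c hcδ hδ w hw hG' hG'd
  have hq : hermForm (conjLocal E c v) G₁ x x = g * n₀ := by
    rw [hermForm_matrix_smul₂] at hx
    have h2 := congrArg (fun s => (qu : LocalRing E v) * s) hx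
    simp only [← mul_assoc, Units.mul_inv, one_mul, mul_one] at h2
    rw [h2, hqu]
  -- the re-framing matrix and its Gram blocks
  set P₀m : Matrix (Fin 3) (Fin 3) (LocalRing E v) :=
    !![conjLocal E c v (x 0) * G₁ 0 1 + conjLocal E c v (x 1) * G₁ 1 1, 0, x 0; -(conjLocal E c v (x 0) * G₁ 0 0 + conjLocal E c v (x 1) * G₁ 1 0), 0, x 1; 0, 1, 0]
    with hP₀m
  have hdet : P₀m.det = -(g * n₀) := by rw [hP₀m, det_reframe, hq]
  have hdetU : IsUnit P₀m.det := by rw [hdet]; exact (hg.mul hn₀u).neg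
  set P₀ : GL (Fin (2 + 1)) (LocalRing E v) := Matrix.nonsingInvUnit P₀m hdetU with hP₀
  have hP₀v : P₀.val = P₀m := rfl
  set xp : Fin 2 → LocalRing E v := ![conjLocal E c v (x 0) * G₁ 0 1 + conjLocal E c v (x 1) * G₁ 1 1, -(conjLocal E c v (x 0) * G₁ 0 0 + conjLocal E c v (x 1) * G₁ 1 0)]
    with hxp
  have hframe : twistGram (conjLocal E c v) (finSum 2 1 G₁ !![g]) P₀.val =
      finSum 2 1 !![hermForm (conjLocal E c v) G₁ xp xp, 0; 0, g] !![hermForm (conjLocal E c v) G₁ x x] := by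
    rw [hP₀v, hP₀m, hxp]
    exact twistGram_finSum_reframe (conjLocal E c v) hσ hG₁ g x
  refine ⟨P₀, !![hermForm (conjLocal E c v) G₁ xp xp, 0; 0, g], !![hermForm (conjLocal E c v) G₁ x x], hframe, ?_⟩
  -- the class: `det G₁′ · q = N(det P₀) det G₁ g` with `det P₀ = −q`, `q = g n₀` σ-fixed ⇒ `det G₁′ = det G₁ · n₀ · N(g)`
  have hdd : (!![hermForm (conjLocal E c v) G₁ xp xp, 0; 0, g] : Matrix (Fin 2) (Fin 2) (LocalRing E v)).det * hermForm (conjLocal E c v) G₁ x x =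
      conjLocal E c v P₀m.det * (G₁.det * g) * P₀m.det := by
    have h := congrArg Matrix.det hframe
    rw [det_twistGram, det_finSum, det_finSum, Matrix.det_fin_one_of, Matrix.det_fin_one_of, hP₀v] at h
    exact h.symm
  rw [hdet, map_neg, hqσ, hq] at hdd
  rintro ⟨z, hzu, hz⟩
  apply hn₀
  obtain ⟨gu, rfl⟩ := hg
  obtain ⟨d₁, hd₁⟩ := hG₁d
  -- cancel the unit `d₁ · (g n₀)`: `σz·z = g·g·n₀`
  rw [hz, ← hd₁] at hdd
  have hzz : conjLocal E c v z * z = (gu : LocalRing E v) * (gu : LocalRing E v) * n₀ := by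
    have h1 : ((d₁ : LocalRing E v) * ((gu : LocalRing E v) * n₀)) * (conjLocal E c v z * z) =
        ((d₁ : LocalRing E v) * ((gu : LocalRing E v) * n₀)) * ((gu : LocalRing E v) * (gu : LocalRing E v) * n₀) := by
      linear_combination hdd
    exact (d₁.isUnit.mul (gu.isUnit.mul hn₀u)).mul_left_cancel h1
  have hgi : (gu : LocalRing E v) * ((gu⁻¹ : (LocalRing E v)ˣ) : LocalRing E v) = 1 := gu.mul_inv
  have hσgi : conjLocal E c v ((gu⁻¹ : (LocalRing E v)ˣ) : LocalRing E v) = ((gu⁻¹ : (LocalRing E v)ˣ) : LocalRing E v) := by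
    have h1 : conjLocal E c v (gu : LocalRing E v) * conjLocal E c v ((gu⁻¹ : (LocalRing E v)ˣ) : LocalRing E v) = 1 := by rw [← map_mul, hgi, map_one]
    rw [hgσ] at h1
    calc conjLocal E c v ((gu⁻¹ : (LocalRing E v)ˣ) : LocalRing E v)
        = ((gu⁻¹ : (LocalRing E v)ˣ) : LocalRing E v) * ((gu : LocalRing E v) * conjLocal E c v ((gu⁻¹ : (LocalRing E v)ˣ) : LocalRing E v)) := by
          rw [← mul_assoc, Units.inv_mul, one_mul]
      _ = _ := by rw [h1, mul_one]
  refine ⟨z * ((gu⁻¹ : (LocalRing E v)ˣ) : LocalRing E v), hzu.mul (gu⁻¹).isUnit, ?_⟩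
  rw [map_mul, hσgi]
  linear_combination (-(((gu⁻¹ : (LocalRing E v)ˣ) : LocalRing E v) * ((gu⁻¹ : (LocalRing E v)ˣ) : LocalRing E v))) * hzz
    + (-(n₀ * ((gu : LocalRing E v) * ((gu⁻¹ : (LocalRing E v)ˣ) : LocalRing E v) + 1))) * hgi

include hcδ hδ in
/-- **THE BAD FRAME.**  `H` hermitian with unit determinant over `E_v` (`v` non-split), `P` a frame of `H` with block-diagonal Gram matrix `G₁ ⊕ᶠ G₂`: there is a frame `P′`
with block-diagonal Gram matrix `G₁′ ⊕ᶠ G₂′` and `det G₁′ ∉ det G₁ · N(E_vˣ)` — `P′ := P·P₀` with `P₀` of `exists_badFrame_of_finSum`.  These are the binders `hP′`, `hnn` of ★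
`exists_unitary_conj_frame_or` ∕ ★ `side_of_dock` ∕ ★ `disj_of_dock`. [cite: Rogawski1990, §3.8 Prop. 3.8.1 (d) p. 30] -/
theorem exists_badFrame (w : PlacesOver E v) (hw : c • w.1 = w.1) {H : Matrix (Fin (2 + 1)) (Fin (2 + 1)) (LocalRing E v)}
    (hH : (H.map (conjLocal E c v))ᵀ = H) (hHd : IsUnit H.det) {P : GL (Fin (2 + 1)) (LocalRing E v)}
    {G₁ : Matrix (Fin 2) (Fin 2) (LocalRing E v)} {G₂ : Matrix (Fin 1) (Fin 1) (LocalRing E v)} (hP : twistGram (conjLocal E c v) H P.val = finSum 2 1 G₁ G₂) :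
    ∃ (P' : GL (Fin (2 + 1)) (LocalRing E v)) (G₁' : Matrix (Fin 2) (Fin 2) (LocalRing E v)) (G₂' : Matrix (Fin 1) (Fin 1) (LocalRing E v)),
      twistGram (conjLocal E c v) H P'.val = finSum 2 1 G₁' G₂' ∧ ¬ ∃ z : LocalRing E v, IsUnit z ∧ G₁'.det = G₁.det * (conjLocal E c v z * z) := by
  have hσ : ∀ s, conjLocal E c v (conjLocal E c v s) = s := Liu2021.LemD1OfPlace.conjLocal_conjLocal_apply E v c hcδ hδ
  -- the blocks: `G₁` hermitian with unit determinant, `g := G₂ 0 0` a `σ`-fixed unit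
  have hGh : ((finSum 2 1 G₁ G₂).map (conjLocal E c v))ᵀ = finSum 2 1 G₁ G₂ := by rw [← hP]; exact conjTranspose_twistGram (conjLocal E c v) H hσ hH P.val
  have hG₂ : G₂ = !![G₂ 0 0] := by ext i j; fin_cases i; fin_cases j; rfl
  rw [finSum_two_one_eq₃] at hGh
  have hG₁ : (G₁.map (conjLocal E c v))ᵀ = G₁ := by
    refine Matrix.ext fun i j => ?_
    fin_cases i <;> fin_cases j
    · have h := congrFun (congrFun hGh 0) 0; simpa [Matrix.transpose_apply, Matrix.map_apply] using h
    · have h := congrFun (congrFun hGh 0) 1; simpa [Matrix.transpose_apply, Matrix.map_apply] using h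
    · have h := congrFun (congrFun hGh 1) 0; simpa [Matrix.transpose_apply, Matrix.map_apply] using h
    · have h := congrFun (congrFun hGh 1) 1; simpa [Matrix.transpose_apply, Matrix.map_apply] using h
  have hgσ : conjLocal E c v (G₂ 0 0) = G₂ 0 0 := by
    have h := congrFun (congrFun hGh 2) 2; simpa [Matrix.transpose_apply, Matrix.map_apply] using h
  have hdets : IsUnit (G₁.det * G₂ 0 0) := by
    have h := congrArg Matrix.det hP
    rw [det_twistGram, det_finSum, Matrix.det_fin_one] at h
    rw [← h]
    have hPu : IsUnit (P.val : Matrix (Fin (2 + 1)) (Fin (2 + 1)) (LocalRing E v)).det := (Matrix.isUnits_det_units P)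
    exact ((hPu.map (conjLocal E c v)).mul hHd).mul hPu
  have hG₁d : IsUnit G₁.det := isUnit_of_mul_isUnit_left hdets
  have hg : IsUnit (G₂ 0 0) := isUnit_of_mul_isUnit_right hdets
  obtain ⟨P₀, G₁', G₂', hP₀, hnn⟩ := exists_badFrame_of_finSum E v c hcδ hδ w hw hG₁ hG₁d hgσ hg
  refine ⟨P * P₀, G₁', G₂', ?_, hnn⟩
  rw [Units.val_mul, twistGram_mul, hP, hG₂, ← twistGram_def, hP₀]

end Local

/-! ## §3 CM dress: the bad frame off the dock frame of `ε` -/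

section CM

variable (L : Type) [Field L] [NumberField L] [IsCMField L] (H' : Matrix (Fin 3) (Fin 3) L) (v : HeightOneSpectrum (𝓞 ↥(maximalRealSubfield L)))

/-- **THE BAD FRAME OFF THE DOCK** (CM carriers).  `H′` hermitian non-degenerate, `v` non-split (`c•w = w`), `εH = (a·1₂, u)` central in `H_v` with `u ≠ a`, `ε = y·ι_v(εH)·y⁻¹ ∈ G′_v`
and `W` the swap `e₂ ↔ e₃`: the dock frame `y·W` has a block-diagonal Gram matrix `G₁ ⊕ᶠ G₂` (★ `twistGram_dockFrame_eq_finSum`) AND there is a second frame `P′` with block-diagonal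
Gram matrix `G₁′ ⊕ᶠ G₂′` in the OTHER class, `det G₁′ ∉ det G₁ · N` — the data `hPW`, `hP′`, `hnn` of ★ `side_of_dock` ∕ ★ `disj_of_dock`.  (The element `ε′ := P′(a·1₂ ⊕ᶠ u)P′⁻¹`
of `G′_v` is then the representative of the second class of Rogawski's Prop. 3.8.1 (d).) [cite: Rogawski1990, §3.8 Prop. 3.8.1 (d) p. 30; §4.8 p. 53] -/
theorem exists_badFrame_dock (w : PlacesOver L v) (hw : IsCMField.complexConj L • w.1 = w.1)
    (hH' : (H'.map (cmConjRingHom L))ᵀ = H') (hdet' : H'.det ≠ 0)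
    (εH : ((cmDatum L 2 (Matrix.of fun i j : Fin 2 => if i.val + j.val + 1 = 2 then (1 : L) else 0)).Local v ×
      (cmDatum L 1 (Matrix.of fun i j : Fin 1 => if i.val + j.val + 1 = 1 then (1 : L) else 0)).Local v)) (a : LocalRing L v)
    (ha : (εH.1.val.val : Matrix (Fin 2) (Fin 2) (LocalRing L v)) = a • (1 : Matrix (Fin 2) (Fin 2) (LocalRing L v)))
    (hu : (εH.2.val.val : Matrix (Fin 1) (Fin 1) (LocalRing L v)) 0 0 ≠ a)
    {ε : (cmDatum L 3 H').Local v} {y : GL (Fin 3) (LocalRing L v)} (hy : y * ((endoEmbLocal L v εH).val : GL (Fin 3) (LocalRing L v)) * y⁻¹ = ε.val)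
    {W : GL (Fin 3) (LocalRing L v)} (hW : W.val = !![(1 : LocalRing L v), 0, 0; 0, 0, 1; 0, 1, 0]) :
    ∃ (G₁ : Matrix (Fin 2) (Fin 2) (LocalRing L v)) (G₂ : Matrix (Fin 1) (Fin 1) (LocalRing L v)) (P' : GL (Fin 3) (LocalRing L v))
      (G₁' : Matrix (Fin 2) (Fin 2) (LocalRing L v)) (G₂' : Matrix (Fin 1) (Fin 1) (LocalRing L v)),
      twistGram (conjLocal L (IsCMField.complexConj L) v) ((adelicForm L 3 H').map (adeleToLocal L v)) (y * W).val = finSum 2 1 G₁ G₂ ∧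
        twistGram (conjLocal L (IsCMField.complexConj L) v) ((adelicForm L 3 H').map (adeleToLocal L v)) P'.val = finSum 2 1 G₁' G₂' ∧
          ¬ ∃ z : LocalRing L v, IsUnit z ∧ G₁'.det = G₁.det * (conjLocal L (IsCMField.complexConj L) v z * z) := by
  haveI : Algebra.IsQuadraticExtension ↥(maximalRealSubfield L) L := IsCMField.isQuadraticExtension L
  -- an anti-fixed non-zero `δ`
  obtain ⟨δ, hcδ, hδ⟩ : ∃ δ : L, IsCMField.complexConj L δ = -δ ∧ δ ≠ 0 := by
    have hne : IsCMField.complexConj L ≠ 1 := IsCMField.complexConj_ne_one (K := L)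
    obtain ⟨z, hz⟩ : ∃ z : L, IsCMField.complexConj L z ≠ z := by
      by_contra hall
      exact hne (AlgEquiv.ext fun z => not_not.mp (not_exists.mp hall z))
    refine ⟨z - IsCMField.complexConj L z, ?_, sub_ne_zero.2 (Ne.symm hz)⟩
    rw [map_sub, IsCMField.complexConj_apply_apply, neg_sub]
  have hHv := map_conjLocal_transpose_localForm L 3 H' v hH'
  have hHvd := isUnit_det_localForm L 3 H' v hdet'
  obtain ⟨G₁, G₂, hPW⟩ := twistGram_dockFrame_eq_finSum L H' v w hw εH a ha hu hy hW
  obtain ⟨P', G₁', G₂', hP', hnn⟩ := exists_badFrame L v (IsCMField.complexConj L) hcδ hδ w hw hHv hHvd hPW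
  exact ⟨G₁, G₂, P', G₁', G₂', hPW, hP', hnn⟩

end CM

end Literature.NumberTheory.Rogawski1990

end
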